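import Literature.AlgebraicGeometry.Resolution.HilbertSamuelLocal
import Literature.AlgebraicGeometry.Resolution.ResolutionGlue
import Mathlib.AlgebraicGeometry.Morphisms.Proper
import Mathlib.AlgebraicGeometry.Limits
import HarnessLib

/-!
# Gluing a local witness into a `Σ^max`-modification
# (crux `SigmaMaxModifications`, stmt-ResolutionOfSingularities-18506, line `Sketch`)

Stub `sigmaMaxModification_of_localWitness` of the lead skeleton: the purely scheme-theoretic
GLUING step behind Cossart–Jannsen–Saito, LNM 2270, Def. 6.15. Let `X` be a reduced locally
Noetherian scheme of dimension `≤ N`, covered by the opens `Zc = X ∖ X_max` and `U₁`, and let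
`ρ : Y → U₁` be a "local witness": proper, `Y` reduced of dimension `≤ N`, an isomorphism over
`W = U₁ ∩ Zc` with dense preimage of `W`, `H^N` non-increasing along `ρ`, and no maximal value of
`Σ_X` a value of `Σ_Y`. Then `ρ` extends BY THE IDENTITY over `Zc` to a proper `π : X' → X` with
the seven clauses of a `Σ^max`-modification.

Construction (Stacks 01LH / 01JA, gluing of schemes along opens, in Mathlib's form "pushouts of
two open immersions exist and are computed by the locally directed gluing",
`Mathlib.AlgebraicGeometry.Limits`): `X'` is the pushout of `Y ↩ ρ⁻¹(W) ↪ Zc`, the second arrow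
being `ρ⁻¹(W) ≅ W ↪ Zc`; `π` is induced by `ρ ≫ U₁.ι` and `Zc.ι`. The two structure maps
`Y → X'`, `Zc → X'` are jointly surjective open immersions with ranges `π⁻¹(U₁)`, `π⁻¹(Zc)`, so
`π|_{U₁} ≅ ρ` is proper and `π|_{Zc} ≅ 𝟙` is an isomorphism (properness is Zariski-local on the
target); reducedness, the dimension bound and the Hilbert–Samuel clauses are checked on stalks /
points through the two open immersions.
-/

set_option linter.dupNamespace false -- mandated namespace of this single-conjunct summit

noncomputable section

open CategoryTheory CategoryTheory.Limits AlgebraicGeometry TopologicalSpace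
open Literature.AlgebraicGeometry.Resolution Literature.RingTheory.HilbertSamuel

namespace Summit.ResolutionOfSingularities.ResolutionOfSingularities.Theorems.SigmaMaxModifications.Sketch

universe u

/-! ## Pushouts of two open immersions: the structure maps -/

section Pushout

variable {W Y Z : Scheme.{u}} (f : W ⟶ Y) (g : W ⟶ Z) [IsOpenImmersion f] [IsOpenImmersion g]

/-- The first structure map of the pushout of two open immersions is an open immersion (the
pushout is Mathlib's locally directed gluing, Stacks 01JA). [cite: StacksProject, Tag 01JA] -/
private theorem isOpenImmersion_pushoutInl : IsOpenImmersion (pushout.inl f g) :=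
  inferInstanceAs (IsOpenImmersion (colimit.ι (span f g) WalkingSpan.left))

/-- The second structure map of the pushout of two open immersions is an open immersion.
[cite: StacksProject, Tag 01JA] -/
private theorem isOpenImmersion_pushoutInr : IsOpenImmersion (pushout.inr f g) :=
  inferInstanceAs (IsOpenImmersion (colimit.ι (span f g) WalkingSpan.right))

/-- The two structure maps of the pushout of two open immersions are jointly surjective.
[cite: StacksProject, Tag 01JA] -/
private theorem pushout_cases (x : ↑(pushout f g)) :
    (∃ y : Y, pushout.inl f g y = x) ∨ (∃ z : Z, pushout.inr f g z = x) := by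
  obtain ⟨j, xj, h⟩ := Scheme.IsLocallyDirected.ι_jointly_surjective (span f g) x
  rcases j with _ | _ | _
  · left
    refine ⟨f xj, ?_⟩
    rw [← h, ← colimit.w (span f g) WalkingSpan.Hom.fst, Scheme.Hom.comp_apply]
    rfl
  · exact Or.inl ⟨xj, h⟩
  · exact Or.inr ⟨xj, h⟩

end Pushout

/-! ## The glued scheme -/

/-- **Gluing along an open (Stacks 01LH / 01JA).** For opens `Zc, U₁ ⊆ X` and `ρ : Y → U₁` an
isomorphism over `U₁ ∩ Zc`, the pushout `X'` of `Y ↩ ρ⁻¹(U₁ ∩ Zc) ↪ Zc` carries `π : X' → X`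
restricting to `ρ` over `U₁` and to the identity over `Zc`: the structure maps `Y → X'`,
`Zc → X'` are jointly surjective open immersions with ranges exactly `π⁻¹(U₁)` and `π⁻¹(Zc)`.
[cite: StacksProject, Tag 01LH] -/
private theorem exists_glue {X Y : Scheme.{u}} (Zc U₁ : X.Opens) (ρ : Y ⟶ U₁)
    [IsIso (ρ ∣_ (U₁.ι ⁻¹ᵁ Zc))] :
    ∃ (X' : Scheme.{u}) (π : X' ⟶ X) (inl : Y ⟶ X') (inr : (Zc : Scheme.{u}) ⟶ X'),
      IsOpenImmersion inl ∧ IsOpenImmersion inr ∧ inl ≫ π = ρ ≫ U₁.ι ∧ inr ≫ π = Zc.ι ∧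
      (∀ x' : X', (∃ y, inl y = x') ∨ (∃ z, inr z = x')) ∧
      (∀ x' : X', (∃ y, inl y = x') ↔ π x' ∈ U₁) ∧
      (∀ x' : X', (∃ z, inr z = x') ↔ π x' ∈ Zc) := by
  -- the open immersion `ρ⁻¹(U₁ ∩ Zc) ≅ U₁ ∩ Zc ↪ Zc`
  obtain ⟨i₂, hi₂⟩ : ∃ i₂ : (↑(ρ ⁻¹ᵁ (U₁.ι ⁻¹ᵁ Zc)) : Scheme.{u}) ⟶ Zc,
      i₂ = (ρ ∣_ (U₁.ι ⁻¹ᵁ Zc)) ≫ (U₁.ι ∣_ Zc) := ⟨_, rfl⟩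
  haveI : IsOpenImmersion i₂ := by rw [hi₂]; infer_instance
  have hi₂π : i₂ ≫ Zc.ι = (ρ ⁻¹ᵁ (U₁.ι ⁻¹ᵁ Zc)).ι ≫ ρ ≫ U₁.ι := by
    rw [hi₂, Category.assoc, morphismRestrict_ι, morphismRestrict_ι_assoc]
  have hi₂pt : ∀ v : ↑(ρ ⁻¹ᵁ (U₁.ι ⁻¹ᵁ Zc)), (i₂ v).1 = U₁.ι (ρ v.1) := by
    intro v
    simp only [hi₂, Scheme.Hom.comp_apply, morphismRestrict_base_coe]
  haveI := isOpenImmersion_pushoutInl (ρ ⁻¹ᵁ (U₁.ι ⁻¹ᵁ Zc)).ι i₂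
  haveI := isOpenImmersion_pushoutInr (ρ ⁻¹ᵁ (U₁.ι ⁻¹ᵁ Zc)).ι i₂
  refine ⟨pushout (ρ ⁻¹ᵁ (U₁.ι ⁻¹ᵁ Zc)).ι i₂, pushout.desc (ρ ≫ U₁.ι) Zc.ι hi₂π.symm,
    pushout.inl _ _, pushout.inr _ _, inferInstance, inferInstance, pushout.inl_desc _ _ _,
    pushout.inr_desc _ _ _, pushout_cases _ _, fun x' => ⟨?_, fun hx' => ?_⟩,
    fun x' => ⟨?_, fun hx' => ?_⟩⟩
  · rintro ⟨y, rfl⟩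
    rw [← Scheme.Hom.comp_apply, pushout.inl_desc, Scheme.Hom.comp_apply]
    exact (ρ y).2
  · rcases pushout_cases _ i₂ x' with ⟨y, rfl⟩ | ⟨z, rfl⟩
    · exact ⟨y, rfl⟩
    · rw [← Scheme.Hom.comp_apply, pushout.inr_desc] at hx'
      -- `z ∈ Zc ∩ U₁` is hit by `i₂`
      obtain ⟨v, hv⟩ := (ρ ∣_ (U₁.ι ⁻¹ᵁ Zc)).surjective ⟨⟨z.1, hx'⟩, z.2⟩
      have hvz : i₂ v = z := by
        apply Subtype.ext
        rw [hi₂pt, ← morphismRestrict_base_coe ρ (U₁.ι ⁻¹ᵁ Zc) v, hv]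
        rfl
      exact ⟨(ρ ⁻¹ᵁ (U₁.ι ⁻¹ᵁ Zc)).ι v, by
        rw [← Scheme.Hom.comp_apply, pushout.condition, Scheme.Hom.comp_apply, hvz]⟩
  · rintro ⟨z, rfl⟩
    rw [← Scheme.Hom.comp_apply, pushout.inr_desc]
    exact z.2
  · rcases pushout_cases _ i₂ x' with ⟨y, rfl⟩ | ⟨z, rfl⟩
    · rw [← Scheme.Hom.comp_apply, pushout.inl_desc, Scheme.Hom.comp_apply] at hx'
      exact ⟨i₂ ⟨y, hx'⟩, by
        rw [← Scheme.Hom.comp_apply, ← pushout.condition, Scheme.Hom.comp_apply]; rfl⟩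
    · exact ⟨z, rfl⟩

/-! ## Consequences of the range descriptions -/

/-- If an open immersion `j : U → X'` over `X` has range `π⁻¹(U)`, then `π` is an isomorphism
over `U`. [folklore] -/
private theorem isIso_morphismRestrict_of_range {X' X : Scheme.{u}} (π : X' ⟶ X) (U : X.Opens)
    (j : (U : Scheme.{u}) ⟶ X') [IsOpenImmersion j] (hj : j ≫ π = U.ι)
    (hr : ∀ x' : X', (∃ u, j u = x') ↔ π x' ∈ U) : IsIso (π ∣_ U) := by
  have hrange : Set.range j = Set.range (π ⁻¹ᵁ U).ι := by
    rw [Scheme.Opens.range_ι]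
    ext x'
    exact hr x'
  have he : (IsOpenImmersion.isoOfRangeEq j (π ⁻¹ᵁ U).ι hrange).hom ≫ (π ∣_ U) = 𝟙 _ := by
    rw [← cancel_mono U.ι, Category.assoc, morphismRestrict_ι, Category.id_comp,
      IsOpenImmersion.isoOfRangeEq_hom_fac_assoc, hj]
  rw [(Iso.hom_comp_eq_id _).mp he]
  infer_instance

/-- If an open immersion `j : Y → X'` has range `π⁻¹(U)` and `j ≫ π = ρ ≫ U.ι` with `ρ` proper,
then `π` is proper over `U`. [folklore] -/
private theorem isProper_morphismRestrict_of_range {X' X Y : Scheme.{u}} (π : X' ⟶ X)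
    (U : X.Opens) (ρ : Y ⟶ U) [IsProper ρ] (j : Y ⟶ X') [IsOpenImmersion j]
    (hj : j ≫ π = ρ ≫ U.ι) (hr : ∀ x' : X', (∃ y, j y = x') ↔ π x' ∈ U) :
    IsProper (π ∣_ U) := by
  have hrange : Set.range j = Set.range (π ⁻¹ᵁ U).ι := by
    rw [Scheme.Opens.range_ι]
    ext x'
    exact hr x'
  have he : (IsOpenImmersion.isoOfRangeEq j (π ⁻¹ᵁ U).ι hrange).hom ≫ (π ∣_ U) = ρ := by
    rw [← cancel_mono U.ι, Category.assoc, morphismRestrict_ι,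
      IsOpenImmersion.isoOfRangeEq_hom_fac_assoc, hj]
  have : π ∣_ U = (IsOpenImmersion.isoOfRangeEq j (π ⁻¹ᵁ U).ι hrange).inv ≫ ρ := by
    rw [← he, Iso.inv_hom_id_assoc]
  rw [this]
  infer_instance

/-- A scheme covered by two open immersions from reduced schemes is reduced (reducedness is a
property of the stalks). [folklore] -/
private theorem isReduced_of_jointly_surjective {X' Y Z : Scheme.{u}} [IsReduced Y] [IsReduced Z]
    (inl : Y ⟶ X') (inr : Z ⟶ X') [IsOpenImmersion inl] [IsOpenImmersion inr]
    (h : ∀ x' : X', (∃ y, inl y = x') ∨ (∃ z, inr z = x')) : IsReduced X' := by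
  have key : ∀ x' : X', _root_.IsReduced (X'.presheaf.stalk x') := by
    intro x'
    rcases h x' with ⟨y, rfl⟩ | ⟨z, rfl⟩
    · exact isReduced_of_injective _ (asIso <| inl.stalkMap y).commRingCatIsoToRingEquiv.injective
    · exact isReduced_of_injective _ (asIso <| inr.stalkMap z).commRingCatIsoToRingEquiv.injective
  exact isReduced_of_isReduced_stalk _

/-- `dim X ≤ n` iff every point has coheight `≤ n` in the specialisation order (irreducible closed
subsets of the sober space `X` are closures of points). [folklore] -/
private theorem topologicalKrullDim_le_iff_coheight_le (S : Scheme.{u}) (n : ℕ) :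
    topologicalKrullDim S ≤ n ↔ ∀ s : S, Order.coheight s ≤ n := by
  have h : topologicalKrullDim S = Order.krullDim S :=
    Order.krullDim_eq_of_orderIso (irreducibleSetEquivPoints (α := S))
  rw [h, Order.krullDim_eq_iSup_coheight, iSup_le_iff]
  exact forall_congr' fun s => by exact_mod_cast Iff.rfl

/-- A scheme covered by two open immersions from schemes of dimension `≤ n` has dimension `≤ n`
(coheights of points are unchanged under open immersions, Stacks 02I4). [cite: StacksProject, Tag 02I4] -/
private theorem topologicalKrullDim_le_of_jointly_surjective {X' Y Z : Scheme.{u}} {n : ℕ}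
    (inl : Y ⟶ X') (inr : Z ⟶ X') [IsOpenImmersion inl] [IsOpenImmersion inr]
    (h : ∀ x' : X', (∃ y, inl y = x') ∨ (∃ z, inr z = x'))
    (hY : topologicalKrullDim Y ≤ n) (hZ : topologicalKrullDim Z ≤ n) :
    topologicalKrullDim X' ≤ n := by
  rw [topologicalKrullDim_le_iff_coheight_le] at hY hZ ⊢
  intro x'
  rcases h x' with ⟨y, rfl⟩ | ⟨z, rfl⟩
  · rw [coheight_eq_of_isOpenImmersion]
    exact hY y
  · rw [coheight_eq_of_isOpenImmersion]
    exact hZ z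

/-- **Open immersions preserve the Hilbert–Samuel function** (variant of
`Scheme.hsFun_eq_of_isOpenImmersion` with the Noetherian hypothesis on the source).
[cite: CossartJannsenSaito2020, Def. 2.28] -/
private theorem hsFun_eq_of_isOpenImmersion' {X Y : Scheme.{u}} (f : X ⟶ Y)
    [IsLocallyNoetherian X] [IsOpenImmersion f] (N : ℕ) (x : X) :
    Scheme.hsFun X N x = Scheme.hsFun Y N (f x) := by
  rw [Scheme.hsFun, Scheme.hsFun, Scheme.hsPhi_eq_of_isIso_stalkMap f N x]
  exact hilbertSamuelFun_eq_of_ringEquiv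
    (asIso (f.stalkMap x)).commRingCatIsoToRingEquiv.symm _

/-! ## The stub -/

/-- **GLUING — a witness given over an open neighbourhood of `X_max` extends by the identity**
(CJS Def. 6.15 bookkeeping; gluing of schemes along an open, Stacks 01LH). Let `X` be reduced,
locally Noetherian, of dimension `≤ N`, covered by the opens `Zc = X ∖ X_max` and `U₁`, and let
`ρ : Y → U₁` be proper with `Y` reduced of dimension `≤ N`, an isomorphism over `U₁ ∩ Zc` with
dense preimage, `H^N` non-increasing, and killing every maximal value of `Σ_X`. Glue `ρ` with the
identity of `Zc` along `ρ⁻¹(U₁ ∩ Zc) ≅ U₁ ∩ Zc`: the result `π : X' → X` is proper (Zariski-locally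
on `X`: `ρ` over `U₁`, an isomorphism over `Zc`), `X'` is reduced of dimension `≤ N` (stalks and
coheights through the two open charts), `π` is an isomorphism over every open inside `X ∖ X_max`
with dense preimage of `X ∖ X_max`, `H^N` is non-increasing (the Hilbert–Samuel function is local,
CJS Def. 2.28) and no maximal value of `Σ_X` is a value of `Σ_{X'}` (a value at a point of the
chart `Zc = X ∖ X_max` is a non-maximal value of `Σ_X`).
[cite: StacksProject, Tag 01LH] [cite: CossartJannsenSaito2020, Def. 6.15] -/
theorem sigmaMaxModification_of_localWitness :
    ∀ (X : Scheme.{0}) [IsLocallyNoetherian X] [IsReduced X] (N : ℕ),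
      topologicalKrullDim X ≤ (N : WithBot ℕ∞) → ∀ (Zc U₁ : X.Opens),
      (Zc : Set X) = (Scheme.hsMaxLocus X N)ᶜ → Zc ⊔ U₁ = ⊤ →
      ∀ (Y : Scheme.{0}) (ρ : Y ⟶ (U₁ : Scheme.{0})), IsProper ρ → IsReduced Y →
      topologicalKrullDim Y ≤ (N : WithBot ℕ∞) → IsIso (ρ ∣_ (U₁.ι ⁻¹ᵁ Zc)) →
      Dense ((ρ ⁻¹ᵁ (U₁.ι ⁻¹ᵁ Zc) : Y.Opens) : Set Y) →
      (∀ y : Y, Scheme.hsFun Y N y ≤ Scheme.hsFun X N (U₁.ι.base (ρ.base y))) →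
      (∀ ν : ℕ → ℕ, Maximal (· ∈ Scheme.hsValues X N) ν → ν ∉ Scheme.hsValues Y N) →
      ∃ (X' : Scheme.{0}) (π : X' ⟶ X), IsProper π ∧ IsReduced X' ∧
        topologicalKrullDim X' ≤ (N : WithBot ℕ∞) ∧
        (∀ U : X.Opens, (U : Set X) ⊆ (Scheme.hsMaxLocus X N)ᶜ → IsIso (π ∣_ U)) ∧
        Dense ((fun x' => π.base x') ⁻¹' (Scheme.hsMaxLocus X N)ᶜ) ∧
        (∀ x' : X', Scheme.hsFun X' N x' ≤ Scheme.hsFun X N (π.base x')) ∧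
        ∀ ν : ℕ → ℕ, Maximal (· ∈ Scheme.hsValues X N) ν → ν ∉ Scheme.hsValues X' N := by
  intro X _ _ N _hdimX Zc U₁ hZc hcov Y ρ hρ hYred hdimY hiso hdense hmono hmax
  haveI : IsLocallyNoetherian Y := LocallyOfFiniteType.isLocallyNoetherian ρ
  obtain ⟨X', π, inl, inr, hinl, hinr, hπl, hπr, hcases, hrl, hrr⟩ := exists_glue Zc U₁ ρ
  have hπl' : ∀ y : Y, π (inl y) = U₁.ι (ρ y) := fun y => by
    rw [← Scheme.Hom.comp_apply, hπl, Scheme.Hom.comp_apply]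
  have hπr' : ∀ z : Zc, π (inr z) = Zc.ι z := fun z => by
    rw [← Scheme.Hom.comp_apply, hπr]
  -- `π` is an isomorphism over `Zc` and proper over `U₁`, hence proper
  have hPZ : IsIso (π ∣_ Zc) := isIso_morphismRestrict_of_range π Zc inr hπr hrr
  have hPU : IsProper (π ∣_ U₁) := isProper_morphismRestrict_of_range π U₁ ρ inl hπl hrl
  have hP : IsProper π := by
    apply IsZariskiLocalAtTarget.of_forall_exists_morphismRestrict (P := @IsProper)
    intro x
    by_cases hx : x ∈ Zc
    · exact ⟨Zc, hx, inferInstance⟩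
    · refine ⟨U₁, ?_, hPU⟩
      have hx' : x ∈ Zc ⊔ U₁ := by rw [hcov]; exact Opens.mem_top x
      exact (Opens.mem_sup.mp hx').resolve_left hx
  -- dimension of `Zc ⊆ X`
  have hdimZ : topologicalKrullDim (Zc : Scheme.{0}) ≤ (N : WithBot ℕ∞) :=
    (topologicalKrullDim_subspace_le X (Zc : Set X)).trans _hdimX
  refine ⟨X', π, hP, isReduced_of_jointly_surjective inl inr hcases,
    topologicalKrullDim_le_of_jointly_surjective inl inr hcases hdimY hdimZ, ?_, ?_, ?_, ?_⟩
  · -- (ME1): isomorphism over every open inside `X ∖ X_max = Zc`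
    intro U hU
    refine isIso_morphismRestrict_of_le π hPZ fun x hx => ?_
    have hx' : x ∈ (Scheme.hsMaxLocus X N)ᶜ := hU hx
    rwa [← hZc] at hx'
  · -- dense preimage of `X ∖ X_max = Zc`: it is the range of `inr`, which contains `inl(ρ⁻¹ W)`
    rw [← hZc]
    have hsub : ∀ x' : X', (∃ z, inr z = x') → x' ∈ (fun x' => π.base x') ⁻¹' (Zc : Set X) :=
      fun x' hx' => (hrr x').mp hx'
    refine Dense.mono (fun x' hx' => hsub x' hx') ?_
    rw [dense_iff_closure_eq, Set.eq_univ_iff_forall]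
    intro x'
    rcases hcases x' with ⟨y, rfl⟩ | ⟨z, rfl⟩
    · have h1 : inl.base '' closure ((ρ ⁻¹ᵁ (U₁.ι ⁻¹ᵁ Zc) : Y.Opens) : Set Y) ⊆
          closure (inl.base '' ((ρ ⁻¹ᵁ (U₁.ι ⁻¹ᵁ Zc) : Y.Opens) : Set Y)) :=
        image_closure_subset_closure_image inl.continuous
      have h2 : inl.base '' ((ρ ⁻¹ᵁ (U₁.ι ⁻¹ᵁ Zc) : Y.Opens) : Set Y) ⊆
          {x' : X' | ∃ z, inr z = x'} := by
        rintro _ ⟨y', hy', rfl⟩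
        exact (hrr _).mpr (by rw [hπl']; exact hy')
      have h3 : inl y ∈ inl.base '' closure ((ρ ⁻¹ᵁ (U₁.ι ⁻¹ᵁ Zc) : Y.Opens) : Set Y) :=
        ⟨y, by rw [hdense.closure_eq]; exact Set.mem_univ y, rfl⟩
      exact closure_mono h2 (h1 h3)
    · exact subset_closure ⟨z, rfl⟩
  · -- `H^N` is non-increasing
    intro x'
    rcases hcases x' with ⟨y, rfl⟩ | ⟨z, rfl⟩
    · rw [← hsFun_eq_of_isOpenImmersion' inl N y, hπl' y]
      exact hmono y
    · rw [← hsFun_eq_of_isOpenImmersion' inr N z, hπr' z, Scheme.hsFun_opens]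
  · -- (ME2): no maximal value of `Σ_X` survives
    rintro ν hν ⟨x', hx'⟩
    rcases hcases x' with ⟨y, rfl⟩ | ⟨z, rfl⟩
    · exact hmax ν hν ⟨y, by rw [hsFun_eq_of_isOpenImmersion' inl N y, hx']⟩
    · have hz : z.1 ∈ (Zc : Set X) := z.2
      rw [hZc] at hz
      apply hz
      rw [Scheme.mem_hsMaxLocus_iff]
      have : Scheme.hsFun X N z.1 = ν := by
        rw [← hx', ← hsFun_eq_of_isOpenImmersion' inr N z]
        exact (Scheme.hsFun_opens Zc N z).symm
      rwa [this]

end Summit.ResolutionOfSingularities.ResolutionOfSingularities.Theorems.SigmaMaxModifications.Sketch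

end
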